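import Mathlib.Data.Nat.Choose.Basic
import Mathlib.Algebra.BigOperators.Intervals
import Mathlib.Algebra.Order.BigOperators.Group.Finset
import Mathlib.Tactic
import Summits.CriticalPhenomena.PercolationContinuityZ3.Theorems.PercNearOneGluingNoHeavyLowerTailThetaConcave
import HarnessLib

/-!
# Pair values of the untilted partner block: outward propagation of negativity

Support file for the Sahi / Conjecture-P programme of route `PercNearOneGluingNoHeavy`
(`--supports stmt-CriticalPhenomena-4575`, prover prim-l12-p5 gen 28; proof note
`prim-l12-p5/U-PROOF-g28.md` §4–§6).  No definitions, no named facts, no sorries.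

The shell value of the two-block system `(M | n)` at level `b` (block 1 windowed, partner block of `n` coins
untilted: `F₁ = C(n,·)`, `Mo₁(k) = (2k-n)C(n,k)`) is `(x+y)(κ - A(v))`, `x = C(n,b+j)`, `y = C(n,b)`,
`v = 2b+j-n`, with the PAIR VALUE `A(v) = v² - jvθ(v)`, `θ = (y-x)/(y+x)`.
* `first_pair` : `A(1) ≤ κ` under `κ N(N-1) ≥ M n (N-j²)` (`N = M+n`, `M ≥ 1`), via
  `M n (N-j²)(n+1) - (n+1-j²)N(N-1) = (M-1)[(n²-1+j²)M + (n+1-j²)n(n-1)]`;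
* `xg_eq` : the guarded partner count of `…ThetaBound` is `C(n,b+j)`;
* `negprop` (**outward propagation of negativity**, hypothesis `hNP` of `LemmaSNP.lemma_S'`) in ALL regimes of
  `j`: a negative shell value at a level `b₀` above the centre stays nonpositive at all levels `b ≥ b₀` —
  for `1 ≤ j ≤ n` because `A` is valley-shaped (`ThetaConcave.D_step`) with first value `≤ κ`.
-/

namespace Summit.CriticalPhenomena.PercolationContinuityZ3.Theorems

namespace PairValues

open Finset

/-! ### The untilted partner block: pair values and outward propagation of negativity -/

/-- **First pair.**  For `N = M + n`, `t + j = n` (`j ≥ 1`), `M ≥ 1`, `κ ≥ 0`, `κ N(N-1) ≥ M n (N - j²)`: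
the pair value at `v = 1`, `A(1) = 1 - j²/(n+1)`, is at most `κ`; in product form with `y = C(n,b)`,
`x = C(n,b+j) = C(n,b-1)`, `2b = t + 1`: `(x+y)(κ - 1) + j(y - x) ≥ 0`. -/
theorem first_pair (M n j t b : ℕ) (ht : t + j = n) (hj : 1 ≤ j) (hM : 1 ≤ M) (hb : 2 * b = t + 1)
    (κ : ℝ) (hκ : 0 ≤ κ)
    (hκ' : (M : ℝ) * n * (((M : ℝ) + n) - (j : ℝ) ^ 2) ≤ κ * (((M : ℝ) + n) * (((M : ℝ) + n) - 1))) :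
    0 ≤ (((n.choose (b + j) : ℕ) : ℝ) + ((n.choose b : ℕ) : ℝ)) * (κ - 1) +
      (j : ℝ) * (((n.choose b : ℕ) : ℝ) - ((n.choose (b + j) : ℕ) : ℝ)) := by
  obtain ⟨b', rfl⟩ : ∃ b', b = b' + 1 := ⟨b - 1, by omega⟩
  have hx : ((n.choose (b' + 1 + j) : ℕ) : ℝ) = ((n.choose b' : ℕ) : ℝ) := by
    have e : b' + 1 + j = n - b' := by omega
    rw [e, Nat.choose_symm (by omega)]
  rw [hx]
  have hrel := ThetaBound.rel_y n b'
  have hn : ((n : ℝ)) = 2 * (b' : ℝ) + 1 + j := by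
    have : ((n : ℕ) : ℝ) = ((t + j : ℕ) : ℝ) := by rw [ht]
    rw [this]
    push_cast
    have : ((t : ℝ)) = 2 * (b' : ℝ) + 1 := by exact_mod_cast (by omega : t = 2 * b' + 1)
    linarith
  set x : ℝ := ((n.choose b' : ℕ) : ℝ) with hxdef
  set y : ℝ := ((n.choose (b' + 1) : ℕ) : ℝ) with hydef
  have hxnn : 0 ≤ x := by positivity
  have hjr : (1 : ℝ) ≤ j := by exact_mod_cast hj
  have hMr : (1 : ℝ) ≤ M := by exact_mod_cast hM
  have hb1 : (0 : ℝ) < (b' : ℝ) + 1 := by positivity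
  rw [hn] at hrel hκ'
  set nn : ℝ := 2 * (b' : ℝ) + 1 + j with hnn
  have hnn1 : (1 : ℝ) ≤ nn := by
    rw [hnn]
    have : (0 : ℝ) ≤ b' := by positivity
    linarith
  -- (nn+1) κ ≥ nn + 1 - j²
  have hκlow : (nn + 1) - (j : ℝ) ^ 2 ≤ (nn + 1) * κ := by
    by_cases hs : (j : ℝ) ^ 2 ≤ nn + 1
    · have hfac : (M : ℝ) * nn * (((M : ℝ) + nn) - (j : ℝ) ^ 2) * (nn + 1) -
          (nn + 1 - (j : ℝ) ^ 2) * (((M : ℝ) + nn) * (((M : ℝ) + nn) - 1)) =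
          ((M : ℝ) - 1) * ((nn ^ 2 - 1 + (j : ℝ) ^ 2) * M + (nn + 1 - (j : ℝ) ^ 2) * nn * (nn - 1)) := by
        ring
      have hpos : 0 ≤ ((M : ℝ) - 1) *
          ((nn ^ 2 - 1 + (j : ℝ) ^ 2) * M + (nn + 1 - (j : ℝ) ^ 2) * nn * (nn - 1)) := by
        apply mul_nonneg (by linarith)
        have h1 : 0 ≤ (nn ^ 2 - 1 + (j : ℝ) ^ 2) * M := mul_nonneg (by nlinarith) (by linarith)
        have h2 : 0 ≤ (nn + 1 - (j : ℝ) ^ 2) * nn * (nn - 1) :=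
          mul_nonneg (mul_nonneg (by linarith) (by linarith)) (by linarith)
        linarith
      have hNN : 0 < ((M : ℝ) + nn) * (((M : ℝ) + nn) - 1) := by nlinarith
      have h4 : (nn + 1 - (j : ℝ) ^ 2) * (((M : ℝ) + nn) * (((M : ℝ) + nn) - 1)) ≤
          (κ * (nn + 1)) * (((M : ℝ) + nn) * (((M : ℝ) + nn) - 1)) := by
        have := mul_le_mul_of_nonneg_right hκ' (by linarith : (0:ℝ) ≤ nn + 1)
        linarith
      have := le_of_mul_le_mul_right h4 hNN
      linarith
    · push Not at hs
      have : 0 ≤ (nn + 1) * κ := mul_nonneg (by linarith) hκ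
      linarith
  -- conclude with y (b'+1) = x (b'+1+j)
  have hrel' : y * ((b' : ℝ) + 1) = x * ((b' : ℝ) + 1 + j) := by
    rw [hydef, hxdef]
    linarith [hrel]
  have key : ((x + y) * (κ - 1) + (j : ℝ) * (y - x)) * ((b' : ℝ) + 1) =
      x * ((nn + 1) * κ - ((nn + 1) - (j : ℝ) ^ 2)) := by
    rw [hnn]
    linear_combination (κ - 1 + (j : ℝ)) * hrel'
  have h0 : 0 ≤ ((x + y) * (κ - 1) + (j : ℝ) * (y - x)) * ((b' : ℝ) + 1) := by
    rw [key]
    exact mul_nonneg hxnn (by linarith)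
  exact (mul_nonneg_iff_of_pos_right hb1).mp h0

/-- The guarded partner count of `…ThetaBound` is `C(n,b+j)`: `C(n,t-b)·[b ≤ t] = C(n,b+j)` (`t + j = n`). -/
theorem xg_eq (n j t b : ℕ) (ht : t + j = n) :
    (if b ≤ t then ((n.choose (t - b) : ℕ) : ℝ) else 0) = ((n.choose (b + j) : ℕ) : ℝ) := by
  by_cases hb : b ≤ t
  · rw [if_pos hb]
    have e : t - b = n - (b + j) := by omega
    rw [e, Nat.choose_symm (by omega)]
  · rw [if_neg hb, Nat.choose_eq_zero_of_lt (by omega)]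
    simp

/-- **Outward propagation of negativity for the untilted partner block** (`F₁ = C(n,·)`,
`Mo₁(k) = (2k-n)C(n,k)`), in all regimes of `j`: if the shell value
`κ(F₁ b₀ + F₁(b₀+j)) - (2b₀+j-n)(Mo₁ b₀ + Mo₁(b₀+j))` is negative at a level `b₀` above the centre, it is
nonpositive at every level `b ≥ b₀`.  (Shell value `= (x+y)(κ - A(v))`, `A` valley-shaped with first value
`≤ κ`.)  Hypotheses: `M ≥ 1`, `κ ≥ 0`, `κ N(N-1) ≥ M n (N-j²)`, `N = M + n`. -/
theorem negprop (M n j : ℕ) (hM : 1 ≤ M) (κ : ℝ) (hκ : 0 ≤ κ)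
    (hκ' : (M : ℝ) * n * (((M : ℝ) + n) - (j : ℝ) ^ 2) ≤ κ * (((M : ℝ) + n) * (((M : ℝ) + n) - 1))) :
    ∀ b₀ : ℕ, (n : ℝ) ≤ 2 * (b₀ : ℝ) + j →
      κ * (((n.choose b₀ : ℕ) : ℝ) + ((n.choose (b₀ + j) : ℕ) : ℝ)) <
        (2 * (b₀ : ℝ) + j - n) * (((n.choose b₀ : ℕ) : ℝ) * (2 * (b₀ : ℝ) - n) +
          ((n.choose (b₀ + j) : ℕ) : ℝ) * (2 * (((b₀ + j : ℕ)) : ℝ) - n)) →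
      ∀ b, b₀ ≤ b →
        κ * (((n.choose b : ℕ) : ℝ) + ((n.choose (b + j) : ℕ) : ℝ)) -
          (2 * (b : ℝ) + j - n) * (((n.choose b : ℕ) : ℝ) * (2 * (b : ℝ) - n) +
            ((n.choose (b + j) : ℕ) : ℝ) * (2 * (((b + j : ℕ)) : ℝ) - n)) ≤ 0 := by
  intro b₀ hv₀ hneg b hb
  -- support: if b > n everything vanishes
  rcases Nat.lt_or_ge n b with hbn | hbn
  · rw [Nat.choose_eq_zero_of_lt hbn, Nat.choose_eq_zero_of_lt (by omega : n < b + j)]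
    simp
  have hb₀n : b₀ ≤ n := by omega
  -- the shell value in pair form: (x+y)(κ - v²) + j v (y - x), v = 2c + j - n
  have pairform : ∀ c : ℕ, κ * (((n.choose c : ℕ) : ℝ) + ((n.choose (c + j) : ℕ) : ℝ)) -
      (2 * (c : ℝ) + j - n) * (((n.choose c : ℕ) : ℝ) * (2 * (c : ℝ) - n) +
        ((n.choose (c + j) : ℕ) : ℝ) * (2 * (((c + j : ℕ)) : ℝ) - n)) =
      (((n.choose (c + j) : ℕ) : ℝ) + ((n.choose c : ℕ) : ℝ)) * (κ - (2 * (c : ℝ) + j - n) ^ 2) +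
        (j : ℝ) * (2 * (c : ℝ) + j - n) * (((n.choose c : ℕ) : ℝ) - ((n.choose (c + j) : ℕ) : ℝ)) := by
    intro c
    push_cast
    ring
  have hneg' : κ * (((n.choose b₀ : ℕ) : ℝ) + ((n.choose (b₀ + j) : ℕ) : ℝ)) -
      (2 * (b₀ : ℝ) + j - n) * (((n.choose b₀ : ℕ) : ℝ) * (2 * (b₀ : ℝ) - n) +
        ((n.choose (b₀ + j) : ℕ) : ℝ) * (2 * (((b₀ + j : ℕ)) : ℝ) - n)) < 0 := by linarith
  rw [pairform] at hneg' ⊢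
  -- notation
  have hy0pos : 0 < ((n.choose b₀ : ℕ) : ℝ) := by exact_mod_cast Nat.choose_pos hb₀n
  have hypos : 0 < ((n.choose b : ℕ) : ℝ) := by exact_mod_cast Nat.choose_pos hbn
  have hx0nn : 0 ≤ ((n.choose (b₀ + j) : ℕ) : ℝ) := by positivity
  have hxnn : 0 ≤ ((n.choose (b + j) : ℕ) : ℝ) := by positivity
  have hbb : ((b₀ : ℝ)) ≤ b := by exact_mod_cast hb
  rcases Nat.eq_zero_or_pos j with hj0 | hjpos
  · -- j = 0 : pair = 2y(κ - v²)
    subst hj0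
    simp only [Nat.cast_zero, add_zero, zero_mul] at hneg' ⊢
    have hv₀nn : 0 ≤ 2 * (b₀ : ℝ) - n := by
      have := hv₀
      simp only [Nat.cast_zero, add_zero] at this
      linarith
    have h1 : κ - (2 * (b₀ : ℝ) - n) ^ 2 < 0 := by
      by_contra hc
      push Not at hc
      have : 0 ≤ (((n.choose b₀ : ℕ) : ℝ) + ((n.choose b₀ : ℕ) : ℝ)) * (κ - (2 * (b₀ : ℝ) - n) ^ 2) :=
        mul_nonneg (by positivity) hc
      linarith
    have h2 : κ - (2 * (b : ℝ) - n) ^ 2 ≤ 0 := by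
      nlinarith
    have : (((n.choose b : ℕ) : ℝ) + ((n.choose b : ℕ) : ℝ)) * (κ - (2 * (b : ℝ) - n) ^ 2) ≤ 0 :=
      mul_nonpos_of_nonneg_of_nonpos (by positivity) h2
    linarith
  rcases Nat.lt_or_ge n j with hnj | hjn
  · -- n < j : x = 0, pair = y (κ - v(v - j))
    rw [Nat.choose_eq_zero_of_lt (by omega : n < b₀ + j)] at hneg'
    rw [Nat.choose_eq_zero_of_lt (by omega : n < b + j)]
    simp only [Nat.cast_zero, zero_add, sub_zero] at hneg' ⊢
    have hv₀nn : 0 ≤ 2 * (b₀ : ℝ) + j - n := by linarith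
    have hvv : 2 * (b₀ : ℝ) + j - n ≤ 2 * (b : ℝ) + j - n := by linarith
    set v₀ : ℝ := 2 * (b₀ : ℝ) + j - n with hv₀def
    set v : ℝ := 2 * (b : ℝ) + j - n with hv
    -- hneg' : y₀ (κ - v₀²) + j v₀ y₀ < 0  ⟹  κ < v₀ (v₀ - j)
    have h1 : κ - v₀ * (v₀ - j) < 0 := by
      by_contra hc
      push Not at hc
      have : 0 ≤ ((n.choose b₀ : ℕ) : ℝ) * (κ - v₀ * (v₀ - j)) := mul_nonneg hy0pos.le hc
      nlinarith
    have hvj : (j : ℝ) < v₀ := by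
      by_contra hc
      push Not at hc
      have : v₀ * (v₀ - j) ≤ 0 := mul_nonpos_of_nonneg_of_nonpos hv₀nn (by linarith)
      linarith
    have h2 : v₀ * (v₀ - j) ≤ v * (v - j) := by nlinarith
    have h3 : κ - v * (v - j) ≤ 0 := by linarith
    have : ((n.choose b : ℕ) : ℝ) * (κ - v * (v - j)) ≤ 0 := mul_nonpos_of_nonneg_of_nonpos hypos.le h3
    nlinarith
  · -- 1 ≤ j ≤ n : pair values A(v) = v² - j v θ, valley-shaped
    obtain ⟨t, ht⟩ : ∃ t, t + j = n := ⟨n - j, by omega⟩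
    have hn : ((n : ℝ)) = (t : ℝ) + j := by exact_mod_cast ht.symm
    -- A c = v_c² - j v_c θ_c with v_c = 2c - t
    set A : ℕ → ℝ := fun c => (2 * (c : ℝ) - t) ^ 2 - (j : ℝ) * (2 * (c : ℝ) - t) *
      ((((n.choose c : ℕ) : ℝ) - ((n.choose (c + j) : ℕ) : ℝ)) /
        (((n.choose c : ℕ) : ℝ) + ((n.choose (c + j) : ℕ) : ℝ))) with hA
    -- pair(c) = (x+y)(κ - A c) for c ≤ n
    have hpairA : ∀ c, c ≤ n →
        (((n.choose (c + j) : ℕ) : ℝ) + ((n.choose c : ℕ) : ℝ)) * (κ - (2 * (c : ℝ) + j - n) ^ 2) +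
          (j : ℝ) * (2 * (c : ℝ) + j - n) * (((n.choose c : ℕ) : ℝ) - ((n.choose (c + j) : ℕ) : ℝ)) =
        (((n.choose (c + j) : ℕ) : ℝ) + ((n.choose c : ℕ) : ℝ)) * (κ - A c) := by
      intro c hc
      have hyc : 0 < ((n.choose c : ℕ) : ℝ) := by exact_mod_cast Nat.choose_pos hc
      have hxc : 0 ≤ ((n.choose (c + j) : ℕ) : ℝ) := by positivity
      have hne : (((n.choose c : ℕ) : ℝ) + ((n.choose (c + j) : ℕ) : ℝ)) ≠ 0 := by linarith
      rw [hA, hn]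
      simp only
      field_simp
      ring
    -- the difference A(c+1) - A(c) in the form of `ThetaConcave.D_step`
    have hDform : ∀ c, A (c + 1) - A c = 4 * (2 * (c : ℝ) - t + 1) - (j : ℝ) *
        ((2 * (c : ℝ) - t + 2) *
            ((((n.choose (c + 1) : ℕ) : ℝ) - (if c + 1 ≤ t then ((n.choose (t - (c + 1)) : ℕ) : ℝ) else 0)) /
              (((n.choose (c + 1) : ℕ) : ℝ) + (if c + 1 ≤ t then ((n.choose (t - (c + 1)) : ℕ) : ℝ) else 0))) -
          (2 * (c : ℝ) - t) *
            ((((n.choose c : ℕ) : ℝ) - (if c ≤ t then ((n.choose (t - c) : ℕ) : ℝ) else 0)) /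
              (((n.choose c : ℕ) : ℝ) + (if c ≤ t then ((n.choose (t - c) : ℕ) : ℝ) else 0)))) := by
      intro c
      rw [xg_eq n j t c ht, xg_eq n j t (c + 1) ht, hA]
      have e : c + 1 + j = c + j + 1 := by omega
      simp only [e]
      push_cast
      ring
    -- UPSET: above κ the pair values increase
    have upset : ∀ c, t ≤ 2 * c → c + 1 ≤ n → κ < A c → A c ≤ A (c + 1) := by
      intro c
      induction c with
      | zero =>
        intro htc _ hκA
        exfalso
        have ht0 : t = 0 := by omega
        have hA0 : A 0 = 0 := by
          rw [hA, ht0]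
          simp
        linarith
      | succ c ih =>
        intro htc hcn hκA
        rcases Nat.lt_or_ge (2 * c) t with hlt | hge
        · -- c+1 is the first pair: A(c+1) ≤ κ, contradiction
          exfalso
          rcases Nat.lt_or_ge (2 * c + 1) t with hlt2 | hge2
          · -- t = 2c+2, v = 0
            have htc' : t = 2 * c + 2 := by omega
            have : A (c + 1) = 0 := by
              rw [hA, htc']
              push_cast
              ring
            linarith
          · -- t = 2c+1, v = 1
            have htc' : t = 2 * c + 1 := by omega
            have hfp := first_pair M n j t (c + 1) ht hjpos hM (by omega) κ hκ hκ'
            have hpa := hpairA (c + 1) (by omega)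
            have ev : (2 * (((c + 1 : ℕ)) : ℝ) + j - n) = 1 := by
              rw [hn, htc']
              push_cast
              ring
            rw [ev] at hpa
            simp only [one_pow, mul_one] at hpa
            have hsum : 0 < ((n.choose (c + 1 + j) : ℕ) : ℝ) + ((n.choose (c + 1) : ℕ) : ℝ) := by
              have : 0 < ((n.choose (c + 1) : ℕ) : ℝ) := by exact_mod_cast Nat.choose_pos (by omega)
              have : 0 ≤ ((n.choose (c + 1 + j) : ℕ) : ℝ) := by positivity
              linarith
            -- first_pair: 0 ≤ (x+y)(κ-1) + j(y-x) = (x+y)(κ - A(c+1))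
            have h0 : 0 ≤ (((n.choose (c + 1 + j) : ℕ) : ℝ) + ((n.choose (c + 1) : ℕ) : ℝ)) * (κ - A (c + 1)) := by
              rw [← hpa]
              linarith [hfp]
            have : 0 ≤ κ - A (c + 1) := by
              by_contra hc
              push Not at hc
              have := mul_neg_of_pos_of_neg hsum hc
              linarith
            linarith
        · -- from c: D_c ≥ 0 then D_step
          have hDc : 0 ≤ A (c + 1) - A c := by
            by_cases hκc : κ < A c
            · linarith [ih hge (by omega) hκc]
            · push Not at hκc
              linarith
          have hstep := ThetaConcave.D_step n j t ht hjpos c hge (by omega) (by rw [← hDform c]; exact hDc)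
          have e2 : c + 1 + 1 = c + 2 := by omega
          have := hDform (c + 1)
          rw [e2] at this
          push_cast at this
          have e3 : (2 * ((c : ℝ) + 1) - t + 1) = (2 * (c : ℝ) - t + 3) := by ring
          have e4 : (2 * ((c : ℝ) + 1) - t + 2) = (2 * (c : ℝ) - t + 4) := by ring
          have e5 : (2 * ((c : ℝ) + 1) - t) = (2 * (c : ℝ) - t + 2) := by ring
          rw [e3, e4, e5] at this
          have : 0 ≤ A (c + 2) - A (c + 1) := by rw [this]; exact hstep
          have e6 : c + 1 + 1 = c + 2 := by omega
          rw [e6]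
          linarith
    -- from b₀ to b
    have ht₀ : t ≤ 2 * b₀ := by
      have : (n : ℝ) ≤ 2 * (b₀ : ℝ) + j := hv₀
      have : (n : ℕ) ≤ 2 * b₀ + j := by exact_mod_cast this
      omega
    have hA₀ : κ < A b₀ := by
      have hpa := hpairA b₀ hb₀n
      rw [hpa] at hneg'
      by_contra hc
      push Not at hc
      have : 0 ≤ (((n.choose (b₀ + j) : ℕ) : ℝ) + ((n.choose b₀ : ℕ) : ℝ)) * (κ - A b₀) :=
        mul_nonneg (by linarith) (by linarith)
      linarith
    have hchain : ∀ d, b₀ + d ≤ n → κ < A (b₀ + d) := by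
      intro d
      induction d with
      | zero => intro _; simpa using hA₀
      | succ d ihd =>
        intro hd
        have h1 := ihd (by omega)
        have h2 := upset (b₀ + d) (by omega) (by omega) h1
        have e : b₀ + (d + 1) = b₀ + d + 1 := by omega
        rw [e]
        linarith
    obtain ⟨d, rfl⟩ : ∃ d, b = b₀ + d := ⟨b - b₀, by omega⟩
    have hAb := hchain d hbn
    rw [hpairA (b₀ + d) hbn]
    exact mul_nonpos_of_nonneg_of_nonpos (by linarith) (by linarith)

end PairValues

end Summit.CriticalPhenomena.PercolationContinuityZ3.Theorems
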